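import Mathlib
import Summits.Ventures.PercRepro2.CoinKSureAD

/-!
# Entry-state sums of a gate (blind cell PercRepro2, night-2 g24; proofs/NIGHT2-DARC.md §64)

Helpers for the gate-only inequality (SC) of §64: `sum_states_eq` (a state sum of the state
masses against a function of the state is the cluster sum against the function of the cluster's
state), `fiber_lsm` (the state masses of a log-supermodular law are log-supermodular on the state
lattice — Ahlswede–Daykin), `fiber_zero` (a state of mass zero carries no moment).
-/

namespace Summit.Ventures.PercRepro2.Coin

open Classical

section ScStates

variable {V : Type*} [DecidableEq V] {R : Type*} [Field R] [LinearOrder R] [IsStrictOrderedRing R]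

omit [LinearOrder R] [IsStrictOrderedRing R] in
/-- **State sums are cluster sums**: `∑_e N(e) f(e) = ∑_W G'(W) f(W ∩ ent)`. -/
theorem sum_states_eq (U ent : Finset V) (G' f : Finset V → R) :
    ∑ e ∈ ent.powerset, (∑ W ∈ U.powerset.filter (fun W => W ∩ ent = e), G' W) * f e =
      ∑ W ∈ U.powerset, G' W * f (W ∩ ent) := by
  have hmaps : ∀ W ∈ U.powerset, (fun W => W ∩ ent) W ∈ ent.powerset :=
    fun W _ => Finset.mem_powerset.mpr Finset.inter_subset_right
  rw [← Finset.sum_fiberwise_of_maps_to hmaps]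
  refine Finset.sum_congr rfl fun e _ => ?_
  rw [Finset.sum_mul]
  refine Finset.sum_congr rfl fun W hW => ?_
  have h := (Finset.mem_filter.mp hW).2
  rw [h]

omit [LinearOrder R] [IsStrictOrderedRing R] in
/-- The filtered form: `∑_{e : Q e} N(e) f(e) = ∑_{W : Q (W ∩ ent)} G'(W) f(W ∩ ent)`. -/
theorem sum_states_filter_eq (U ent : Finset V) (G' f : Finset V → R) (Q : Finset V → Prop)
    [DecidablePred Q] :
    ∑ e ∈ ent.powerset.filter Q, (∑ W ∈ U.powerset.filter (fun W => W ∩ ent = e), G' W) * f e =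
      ∑ W ∈ U.powerset.filter (fun W => Q (W ∩ ent)), G' W * f (W ∩ ent) := by
  rw [Finset.sum_filter, Finset.sum_filter]
  have key := sum_states_eq U ent G' (fun e => if Q e then f e else 0)
  have e1 : (∑ e ∈ ent.powerset, (∑ W ∈ U.powerset.filter (fun W => W ∩ ent = e), G' W) *
      (if Q e then f e else 0)) =
      ∑ e ∈ ent.powerset, (if Q e then (∑ W ∈ U.powerset.filter (fun W => W ∩ ent = e), G' W) * f e
        else 0) :=
    Finset.sum_congr rfl fun e _ => by split_ifs <;> simp
  have e2 : (∑ W ∈ U.powerset, G' W * (if Q (W ∩ ent) then f (W ∩ ent) else 0)) =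
      ∑ W ∈ U.powerset, (if Q (W ∩ ent) then G' W * f (W ∩ ent) else 0) :=
    Finset.sum_congr rfl fun W _ => by split_ifs <;> simp
  rw [e1, e2] at key
  exact key

/-- **The state masses of a log-supermodular law are log-supermodular**:
`N(e) N(e') ≤ N(e ∩ e') N(e ∪ e')`. -/
theorem fiber_lsm (U ent e e' : Finset V) (G' : Finset V → R) (hG' : ∀ W, 0 ≤ G' W)
    (wMM : ∀ s ⊆ U, ∀ t ⊆ U, G' s * G' t ≤ G' (s ∩ t) * G' (s ∪ t)) :
    (∑ W ∈ U.powerset.filter (fun W => W ∩ ent = e), G' W) *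
        (∑ W ∈ U.powerset.filter (fun W => W ∩ ent = e'), G' W) ≤
      (∑ W ∈ U.powerset.filter (fun W => W ∩ ent = e ∩ e'), G' W) *
        (∑ W ∈ U.powerset.filter (fun W => W ∩ ent = e ∪ e'), G' W) := by
  simp only [Finset.sum_filter]
  have n₁ : ∀ W, (0 : R) ≤ (if W ∩ ent = e then G' W else 0) := fun W => by
    split_ifs <;> [exact hG' W; exact le_rfl]
  have n₂ : ∀ W, (0 : R) ≤ (if W ∩ ent = e' then G' W else 0) := fun W => by
    split_ifs <;> [exact hG' W; exact le_rfl]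
  have n₃ : ∀ W, (0 : R) ≤ (if W ∩ ent = e ∩ e' then G' W else 0) := fun W => by
    split_ifs <;> [exact hG' W; exact le_rfl]
  have n₄ : ∀ W, (0 : R) ≤ (if W ∩ ent = e ∪ e' then G' W else 0) := fun W => by
    split_ifs <;> [exact hG' W; exact le_rfl]
  refine ad_pointwise U _ _ _ _ n₁ n₂ n₃ n₄ ?_
  intro s hs t ht
  by_cases h1 : s ∩ ent = e
  · by_cases h2 : t ∩ ent = e'
    · have h3 : (s ∩ t) ∩ ent = e ∩ e' := by rw [state_inter, h1, h2]
      have h4 : (s ∪ t) ∩ ent = e ∪ e' := by rw [state_union, h1, h2]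
      rw [if_pos h1, if_pos h2, if_pos h3, if_pos h4]
      exact wMM s hs t ht
    · rw [if_neg h2, mul_zero]
      exact mul_nonneg (n₃ _) (n₄ _)
  · rw [if_neg h1, zero_mul]
    exact mul_nonneg (n₃ _) (n₄ _)

omit [LinearOrder R] [IsStrictOrderedRing R] in
/-- A state of mass zero carries no moment: if `∑_{W∩ent=e} G' = 0` then `∑_{W∩ent=e} G' f = 0`
for every `f` (nonnegative weights). -/
theorem fiber_zero [LinearOrder R] [IsStrictOrderedRing R] (U ent e : Finset V) (G' f : Finset V → R)
    (hG' : ∀ W, 0 ≤ G' W)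
    (h : (∑ W ∈ U.powerset.filter (fun W => W ∩ ent = e), G' W) = 0) :
    (∑ W ∈ U.powerset.filter (fun W => W ∩ ent = e), G' W * f W) = 0 := by
  have hz : ∀ W ∈ U.powerset.filter (fun W => W ∩ ent = e), G' W = 0 :=
    (Finset.sum_eq_zero_iff_of_nonneg (fun W _ => hG' W)).mp h
  exact Finset.sum_eq_zero fun W hW => by rw [hz W hW, zero_mul]

end ScStates

end Summit.Ventures.PercRepro2.Coin
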